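import Summits.QuantumFields.YangMills.Theorems.BalabanLadderIRTwistedSlabModelChart
import Literature.Analysis.Asymptotics.LaplaceMethodChartComposition
import HarnessLib

/-!
# The slice chart in B89's currency, II: HAAR MEASURE OF `SU(N)^E` IN THE SLICE-CHART COORDINATES `(φ, y) ↦ e^{φ} • (e^{y}·L)` around the
# twist-eating ladder — the `hchart` identity of M1b (lit-4 L16 applied to the tree's slice chart through the `Ad(Lᴴ)`-twisted frame)

HELPER toward stub **T1** `TwistedSlabAnchor` (LINE `twisted-slab-continuity`, crux `IRcof` stmt-QuantumFields-26930, census row 43;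
LEAD prover ym-ir-line-tsc-p1 g3; `--supports` the crux, `--as helper`).  Sequel of `…TwistedSlabModelChart`; consumes BY NAME lit-4's L16 ★★
`haar_restrict_image_reparam_eq_map_withDensity_frame` (Haar measure of a log-charted compact group in arbitrary `C¹` coordinates through the
exponential chart), `injOn_translate_expChart_frame`, L11 `isChartRep_pi` ∕ `expChart_pi_apply`, B89 `isChartRep_specialUnitaryGroup`,
`lie_adStable_specialUnitaryGroup`, `continuous_det_jac`.  Scope `Matrix.Norms.L2Operator` (see the scope note of part I).
* §1 `sliceChartMap hL D T : V → SU(N)^E` (`z ↦ L · Θ^E(modelFrame (modelPsi z))`), `coe_sliceChartMap_apply` (links `= L(e)·exp(X_e)`),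
  `sliceChartDensity hL D T μ : V → ℝ` (`|det D(modelPsi)| · σ₀ · |det jac ∘ modelFrame ∘ modelPsi|`, Borel structure on `𝔤^E` chosen inside);
  ★★★ `haar_restrict_sliceChartMap_image_eq_map_withDensity`: for `L ∈ SU(N)^E`, an open `S ∋ 0` with `Ψ̂` injective on `S`, any frame `T` and any Haar
  measure `μ` on `SU(N)^E`: an open `W ∋ 0` with `InjOn`, continuous density, links `= orbitFluct L (T z)`, and `μ|_{Φ(W)} = Φ_*((J · dz)|_W)`.
* §2 ★★★ `haar_restrict_sliceChartMap_image_eq_map_withDensity_ladder` — at the twist-eating ladder the chart data are discharged by the inverse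
  function theorem (K15b∕c: `S` = the IFT source, `D = DΨ̂(0) = slicePsiSuDeriv`); `fderiv_modelPsi_zero_ladder` (`D(modelPsi)(0) = id`).
NOT here (honest scope): the product splitting `V = gauge × slice` of the Lebesgue measure and the Faddeev–Popov localisation feeding lit-4's L9
`tendsto_laplaceMethod_fibred_chart`, the value `J(0) = σ₀`, anything uniform in `β` (M3), the cluster expansion (M4); T1-box 0∕1, T1 proper 0∕1.

HONEST FRAMING: measure-theoretic plumbing on one box; nothing here bears on `IRcof`, `IR`, or the Yang–Mills mass gap (Clay: NOT proved); R4 =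
`BalabanLadder.UV` only.  References: S. Helgason, *Groups and Geometric Analysis* Ch. I §1 Thm 1.14 (13) p. 96; K. W. Breitung, *Asymptotic
Approximations for Probability Integrals* (1994) §2.3, Thm 41; I. Montvay, G. Münster, *Quantum Fields on a Lattice* §3.2.5 (3.238).
-/

set_option autoImplicit false

noncomputable section

open scoped Matrix Matrix.Norms.L2Operator Topology ENNReal
open MeasureTheory Filter NormedSpace Set
open Literature.MathematicalPhysics.QuantumFieldTheory Literature.MathematicalPhysics.QuantumLattice
open Literature.Analysis.OperatorTheory
open Literature.MathematicalPhysics.QuantumFieldTheory.Balaban1983to89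
open Literature.MathematicalPhysics.QuantumFieldTheory.Balaban1983to89.HaarExponentialChart
open Literature.MathematicalPhysics.QuantumFieldTheory.Balaban1983to89.LogChartProduct
open Literature.MathematicalPhysics.QuantumFieldTheory.Balaban1983to89.B13HaarSigmaJacobian (jac)
open Literature.Analysis.Asymptotics

namespace Summit.QuantumFields.YangMills.Cruxes.IRcof.TwistedSlab

variable {N : ℕ} [NeZero N] {n₀ n₁ n₂ n₃ : ℕ}

/-! ## §1 Haar measure in the slice-chart coordinates (lit-4 L16 applied) -/

section Haar

variable {L : FinTorusSite n₀ n₁ n₂ n₃ × Fin 4 → Matrix (Fin N) (Fin N) ℂ}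
variable {V : Type*} [NormedAddCommGroup V] [InnerProductSpace ℝ V] [FiniteDimensional ℝ V] [MeasurableSpace V] [BorelSpace V]
variable (hLsu : ∀ e, L e ∈ Matrix.specialUnitaryGroup (Fin N) ℂ)
  (D : (suFields N n₀ n₁ n₂ n₃ × realCoulombSlice L) ≃L[ℝ] (Fin 4 → suFields N n₀ n₁ n₂ n₃))
  (T : V ≃L[ℝ] (suFields N n₀ n₁ n₂ n₃ × realCoulombSlice L))

/-- **The slice-chart map into configurations**: `z ↦ L · Θ^E(modelFrame (modelPsi z))` (B89's right exponential chart of `SU(N)^E` at `L`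
composed with the model chart). [cite: Helgason2000, Ch. I §1 Thm 1.14 (13) p. 96] -/
def sliceChartMap : V → (FinTorusSite n₀ n₁ n₂ n₃ × Fin 4 → Matrix.specialUnitaryGroup (Fin N) ℂ) :=
  fun z => (fun e => (⟨L e, hLsu e⟩ : Matrix.specialUnitaryGroup (Fin N) ℂ)) *
    (isChartRep_pi (FinTorusSite n₀ n₁ n₂ n₃ × Fin 4) (isChartRep_specialUnitaryGroup (n := Fin N))).expChart
      (modelFrame (fun e => (Matrix.mem_specialUnitaryGroup_iff.1 (hLsu e)).1) D T (modelPsi D T z))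

/-- **The slice-chart density** `J(z) = |det D(modelPsi)(z)| · σ₀ · |det jac(modelFrame (modelPsi z))|` (`σ₀` the window constant of the
product chart for the frame's Lebesgue measure). [cite: Helgason2000, Ch. I §1 Thm 1.14 (13) p. 96] [cite: Breitung1994, Thm 41 p. 56] -/
def sliceChartDensity (μ : Measure (FinTorusSite n₀ n₁ n₂ n₃ × Fin 4 → Matrix.specialUnitaryGroup (Fin N) ℂ)) : V → ℝ :=
  letI : MeasurableSpace (piLogChart (specialUnitaryLogChart (Fin N)) (FinTorusSite n₀ n₁ n₂ n₃ × Fin 4)).lie := borel _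
  haveI : BorelSpace (piLogChart (specialUnitaryLogChart (Fin N)) (FinTorusSite n₀ n₁ n₂ n₃ × Fin 4)).lie := ⟨rfl⟩
  let hPi := isChartRep_pi (FinTorusSite n₀ n₁ n₂ n₃ × Fin 4) (isChartRep_specialUnitaryGroup (n := Fin N))
  let hlie := lie_adStable_pi (specialUnitaryLogChart (Fin N)) (FinTorusSite n₀ n₁ n₂ n₃ × Fin 4)
    (lie_adStable_specialUnitaryGroup (n := Fin N))
  let s := IsChartRep.chartRadius (piLogChart (specialUnitaryLogChart (Fin N)) (FinTorusSite n₀ n₁ n₂ n₃ × Fin 4))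
  let e := modelFrame (fun e => (Matrix.mem_specialUnitaryGroup_iff.1 (hLsu e)).1) D T
  fun z => |(fderiv ℝ (modelPsi D T) z).det| *
    ((μ (hPi.window s) / hPi.chartMeasure hlie ((volume : Measure V).map e) s (hPi.window s)).toReal *
      |LinearMap.det (jac hlie (e (modelPsi D T z)) :
        (piLogChart (specialUnitaryLogChart (Fin N)) (FinTorusSite n₀ n₁ n₂ n₃ × Fin 4)).lie →ₗ[ℝ]
          (piLogChart (specialUnitaryLogChart (Fin N)) (FinTorusSite n₀ n₁ n₂ n₃ × Fin 4)).lie)|)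

omit [FiniteDimensional ℝ V] [MeasurableSpace V] [BorelSpace V] in
/-- The links of the slice-chart map: `(sliceChartMap z)(e) = L(e) · exp((modelFrame (modelPsi z))(e))` in `M_N(ℂ)`. [folklore] -/
theorem coe_sliceChartMap_apply (z : V) (e : FinTorusSite n₀ n₁ n₂ n₃ × Fin 4) :
    ((sliceChartMap hLsu D T z e : Matrix.specialUnitaryGroup (Fin N) ℂ) : Matrix (Fin N) (Fin N) ℂ) =
      L e * exp (((modelFrame (fun e => (Matrix.mem_specialUnitaryGroup_iff.1 (hLsu e)).1) D T (modelPsi D T z) :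
          (piLogChart (specialUnitaryLogChart (Fin N)) (FinTorusSite n₀ n₁ n₂ n₃ × Fin 4)).lie) :
            FinTorusSite n₀ n₁ n₂ n₃ × Fin 4 → Matrix (Fin N) (Fin N) ℂ) e) := by
  rw [sliceChartMap, Pi.mul_apply, Submonoid.coe_mul, expChart_pi_apply (FinTorusSite n₀ n₁ n₂ n₃ × Fin 4) (isChartRep_specialUnitaryGroup (n := Fin N)),
    ← fundamentalRep_apply ((isChartRep_specialUnitaryGroup (n := Fin N)).expChart _),
    (isChartRep_specialUnitaryGroup (n := Fin N)).rho_expChart, coe_lieApply]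

/-- ★★★ **HAAR MEASURE OF `SU(N)^E` IN THE SLICE-CHART COORDINATES** (the `hchart` identity of M1b; `L ∈ SU(N)^E`, `S ∋ 0` open with `Ψ̂`
injective on `S` — at the twist eater the IFT source): there is an open `W ∋ 0` in the model space on which the slice-chart map is injective with
links `orbitFluct L (T z)`, the density `J` is continuous, and for every Haar measure `μ` on `SU(N)^E`, `μ|_{Φ(W)} = Φ_*((J · dz)|_W)`.  Proof:
lit-4's `haar_restrict_image_reparam_eq_map_withDensity_frame` for the product chart of `SU(N)^E` at the base point `L`, the frame
`modelFrame` and the `C¹` reparametrisation `modelPsi` (data from §2), applied to the measurable modification `W.piecewise (modelPsi) 0`.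
[cite: Helgason2000, Ch. I §1 Thm 1.14 (13) p. 96] [cite: Breitung1994, §2.3 Definitions 4–5 pp. 14–15; Thm 41 p. 56] [cite: MontvayMunster1994, §3.2.5 (3.238) p. 135] -/
theorem haar_restrict_sliceChartMap_image_eq_map_withDensity
    {S : Set (suFields N n₀ n₁ n₂ n₃ × realCoulombSlice L)} (hSo : IsOpen S)
    (hS0 : (0 : suFields N n₀ n₁ n₂ n₃ × realCoulombSlice L) ∈ S) (hSinj : InjOn (slicePsiSu L) S)
    (μ : Measure (FinTorusSite n₀ n₁ n₂ n₃ × Fin 4 → Matrix.specialUnitaryGroup (Fin N) ℂ)) [μ.IsHaarMeasure] :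
    ∃ W : Set V, IsOpen W ∧ (0 : V) ∈ W ∧ InjOn (sliceChartMap hLsu D T) W ∧
      ContinuousOn (sliceChartDensity hLsu D T μ) W ∧
      (∀ z ∈ W, ∀ (x : FinTorusSite n₀ n₁ n₂ n₃) (μ' : Fin 4),
        ((sliceChartMap hLsu D T z (x, μ') : Matrix.specialUnitaryGroup (Fin N) ℂ) : Matrix (Fin N) (Fin N) ℂ) =
          orbitFluct L (suDataIncl L (T z)) μ' x) ∧
      μ.restrict (sliceChartMap hLsu D T '' W) =
        (((volume : Measure V).restrict W).withDensity fun z => ENNReal.ofReal (sliceChartDensity hLsu D T μ z)).map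
          (sliceChartMap hLsu D T) := by
  classical
  letI : MeasurableSpace (piLogChart (specialUnitaryLogChart (Fin N)) (FinTorusSite n₀ n₁ n₂ n₃ × Fin 4)).lie := borel _
  haveI : BorelSpace (piLogChart (specialUnitaryLogChart (Fin N)) (FinTorusSite n₀ n₁ n₂ n₃ × Fin 4)).lie := ⟨rfl⟩
  haveI : CompleteSpace V := FiniteDimensional.complete ℝ V
  have hLu : ∀ e, L e ∈ Matrix.unitaryGroup (Fin N) ℂ := fun e => (Matrix.mem_specialUnitaryGroup_iff.1 (hLsu e)).1
  have hlie := lie_adStable_pi (specialUnitaryLogChart (Fin N)) (FinTorusSite n₀ n₁ n₂ n₃ × Fin 4)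
    (lie_adStable_specialUnitaryGroup (n := Fin N))
  obtain ⟨W, hWo, hW0, hinj, hderW, hcontD, hcontΨ, hball, hlink⟩ := exists_modelPsi_chartData D T hLu hLsu hSo hS0 hSinj
  have hWm : MeasurableSet W := hWo.measurableSet
  -- the measurable modification of the model chart off `W`
  have hΨ₁W : EqOn (W.piecewise (modelPsi D T) fun _ => 0) (modelPsi D T) W := Set.piecewise_eqOn W _ _
  have hΨ₁m : Measurable (W.piecewise (modelPsi D T) fun _ => 0) := hcontΨ.measurable_piecewise continuousOn_const hWm
  have hΨ₁' : ∀ z ∈ W, HasFDerivWithinAt (W.piecewise (modelPsi D T) fun _ => 0) (fderiv ℝ (modelPsi D T) z) W z :=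
    fun z hz => (hderW z hz).congr hΨ₁W (hΨ₁W hz)
  have hinj₁ : InjOn (W.piecewise (modelPsi D T) fun _ => 0) W := hinj.congr hΨ₁W.symm
  have hΨ'm : Measurable fun z => |(fderiv ℝ (modelPsi D T) z).det| :=
    continuous_abs.measurable.comp (ContinuousLinearMap.continuous_det.measurable.comp (measurable_fderiv ℝ (modelPsi D T)))
  have hΨW₁ : (W.piecewise (modelPsi D T) fun _ => 0) '' W ⊆ (modelFrame hLu D T) ⁻¹' Metric.ball 0
      (IsChartRep.chartRadius (piLogChart (specialUnitaryLogChart (Fin N)) (FinTorusSite n₀ n₁ n₂ n₃ × Fin 4)) / 2) := by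
    rw [hΨ₁W.image_eq]; exact hball
  -- lit-4 L16
  have hmain := haar_restrict_image_reparam_eq_map_withDensity_frame
    (isChartRep_pi (FinTorusSite n₀ n₁ n₂ n₃ × Fin 4) (isChartRep_specialUnitaryGroup (n := Fin N))) hlie μ (modelFrame hLu D T)
    (fun e => (⟨L e, hLsu e⟩ : Matrix.specialUnitaryGroup (Fin N) ℂ)) hΨ₁m hWm hΨ₁' hinj₁ hΨ'm hΨW₁
  have hΦeq : EqOn (sliceChartMap hLsu D T) (fun z => (fun e => (⟨L e, hLsu e⟩ : Matrix.specialUnitaryGroup (Fin N) ℂ)) *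
      (isChartRep_pi (FinTorusSite n₀ n₁ n₂ n₃ × Fin 4) (isChartRep_specialUnitaryGroup (n := Fin N))).expChart
        (modelFrame hLu D T ((W.piecewise (modelPsi D T) fun _ => 0) z))) W := fun z hz => by
    show _ = (fun e => (⟨L e, hLsu e⟩ : Matrix.specialUnitaryGroup (Fin N) ℂ)) * _
    rw [hΨ₁W hz]; rfl
  refine ⟨W, hWo, hW0, ?_, ?_, ?_, ?_⟩
  · -- injectivity: the translated frame chart is injective on the half-window
    have h1 := injOn_translate_expChart_frame
      (isChartRep_pi (FinTorusSite n₀ n₁ n₂ n₃ × Fin 4) (isChartRep_specialUnitaryGroup (n := Fin N))) (modelFrame hLu D T)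
      (fun e => (⟨L e, hLsu e⟩ : Matrix.specialUnitaryGroup (Fin N) ℂ))
    exact h1.comp hinj fun z hz => hball ⟨z, hz, rfl⟩
  · -- continuity of the density
    have h1 : ContinuousOn (fun z => |(fderiv ℝ (modelPsi D T) z).det|) W :=
      continuous_abs.comp_continuousOn (ContinuousLinearMap.continuous_det.comp_continuousOn hcontD)
    have h2 : ContinuousOn (fun z => |LinearMap.det (jac hlie (modelFrame hLu D T (modelPsi D T z)) :
        (piLogChart (specialUnitaryLogChart (Fin N)) (FinTorusSite n₀ n₁ n₂ n₃ × Fin 4)).lie →ₗ[ℝ]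
          (piLogChart (specialUnitaryLogChart (Fin N)) (FinTorusSite n₀ n₁ n₂ n₃ × Fin 4)).lie)|) W :=
      (continuous_abs.comp (continuous_det_jac hlie)).comp_continuousOn ((modelFrame hLu D T).continuous.comp_continuousOn hcontΨ)
    exact h1.mul (continuousOn_const.mul h2)
  · -- the links
    intro z hz x μ'
    rw [coe_sliceChartMap_apply]
    exact hlink z hz x μ'
  · -- the chart identity
    have himg := hΦeq.image_eq
    have hdens : ((volume : Measure V).restrict W).withDensity (fun z => ENNReal.ofReal (sliceChartDensity hLsu D T μ z)) =
        ((volume : Measure V).restrict W).withDensity (fun z => ENNReal.ofReal (|(fderiv ℝ (modelPsi D T) z).det| *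
          ((μ ((isChartRep_pi (FinTorusSite n₀ n₁ n₂ n₃ × Fin 4) (isChartRep_specialUnitaryGroup (n := Fin N))).window
              (IsChartRep.chartRadius (piLogChart (specialUnitaryLogChart (Fin N)) (FinTorusSite n₀ n₁ n₂ n₃ × Fin 4)))) /
              (isChartRep_pi (FinTorusSite n₀ n₁ n₂ n₃ × Fin 4) (isChartRep_specialUnitaryGroup (n := Fin N))).chartMeasure hlie
                ((volume : Measure V).map (modelFrame hLu D T))
                (IsChartRep.chartRadius (piLogChart (specialUnitaryLogChart (Fin N)) (FinTorusSite n₀ n₁ n₂ n₃ × Fin 4)))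
                ((isChartRep_pi (FinTorusSite n₀ n₁ n₂ n₃ × Fin 4) (isChartRep_specialUnitaryGroup (n := Fin N))).window
                  (IsChartRep.chartRadius (piLogChart (specialUnitaryLogChart (Fin N)) (FinTorusSite n₀ n₁ n₂ n₃ × Fin 4))))).toReal *
            |LinearMap.det (jac hlie (modelFrame hLu D T ((W.piecewise (modelPsi D T) fun _ => 0) z)) :
              (piLogChart (specialUnitaryLogChart (Fin N)) (FinTorusSite n₀ n₁ n₂ n₃ × Fin 4)).lie →ₗ[ℝ]
                (piLogChart (specialUnitaryLogChart (Fin N)) (FinTorusSite n₀ n₁ n₂ n₃ × Fin 4)).lie)|))) := by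
      refine withDensity_congr_ae (ae_restrict_of_forall_mem hWm fun z hz => ?_)
      beta_reduce
      rw [hΨ₁W hz]
      rfl
    have hmap : Measure.map (sliceChartMap hLsu D T)
        ((((volume : Measure V).restrict W).withDensity fun z => ENNReal.ofReal (sliceChartDensity hLsu D T μ z))) =
        Measure.map (fun z => (fun e => (⟨L e, hLsu e⟩ : Matrix.specialUnitaryGroup (Fin N) ℂ)) *
          (isChartRep_pi (FinTorusSite n₀ n₁ n₂ n₃ × Fin 4) (isChartRep_specialUnitaryGroup (n := Fin N))).expChart
            (modelFrame hLu D T ((W.piecewise (modelPsi D T) fun _ => 0) z)))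
        ((((volume : Measure V).restrict W).withDensity fun z => ENNReal.ofReal (sliceChartDensity hLsu D T μ z))) := by
      refine Measure.map_congr ((withDensity_absolutelyContinuous _ _).ae_eq ?_)
      exact (ae_restrict_mem hWm).mono fun z hz => hΦeq hz
    rw [himg, hmap, hdens]
    exact hmain

end Haar

/-! ## §2 At the twist-eating ladder: `D = DΨ̂(0)` and `S` = the IFT source -/

section Ladder

variable {m n₂' n₃' : ℕ} {A B : Matrix (Fin N) (Fin N) ℂ} {ω : ℂ} {Γ₂ Γ₃ : Matrix (Fin N) (Fin N) ℂ}
variable {V : Type*} [NormedAddCommGroup V] [InnerProductSpace ℝ V]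

omit [NeZero N] in
/-- At the twist eater, with `D = DΨ̂(0) = slicePsiSuDeriv`, the model chart has derivative `id` at `0`. [cite: Breitung1994, §2.3 Definitions 4–5 pp. 14–15] -/
theorem fderiv_modelPsi_zero_ladder [NeZero N] (hAu : A ∈ Matrix.unitaryGroup (Fin N) ℂ) (hBu : B ∈ Matrix.unitaryGroup (Fin N) ℂ)
    (hω : IsPrimitiveRoot ω N) (hAB : A * B = ω • (B * A)) (hNm : 2 ≤ N * (m + 1))
    (hL : ∀ e, ladderField (n₀ := m + 1) (n₁ := m + 1) (n₂ := n₂') (n₃ := n₃') ![A, B, Γ₂, Γ₃] e ∈ Matrix.specialUnitaryGroup (Fin N) ℂ)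
    (T : V ≃L[ℝ] (suFields N (m + 1) (m + 1) n₂' n₃' ×
      realCoulombSlice (ladderField (n₀ := m + 1) (n₁ := m + 1) (n₂ := n₂') (n₃ := n₃') ![A, B, Γ₂, Γ₃]))) :
    fderiv ℝ (modelPsi (slicePsiSuDeriv hAu hBu hω hAB hNm hL) T) 0 = ContinuousLinearMap.id ℝ V :=
  fderiv_modelPsi_zero _ T (fderiv_slicePsiSu_zero hAu hBu hω hAB hNm hL)

variable [FiniteDimensional ℝ V] [MeasurableSpace V] [BorelSpace V]

/-- ★★★ **THE `hchart` IDENTITY AT THE TWIST-EATING LADDER** (`A, B` a unitary Weyl pair, `ω` primitive, `N(m+1) ≥ 2`, ladder in `SU(N)`): the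
chart data `S` of §3 is discharged by the inverse function theorem (K15b `sliceChart`), `D = DΨ̂(0)`.  For every frame `T` of the `𝔰𝔲` data by a
finite-dimensional real inner-product space and every Haar measure on `SU(N)^E`: an open `W ∋ 0`, injectivity, continuous density, links
`= orbitFluct L (T z)`, and `μ|_{Φ(W)} = Φ_*((J · dz)|_W)`. [cite: Helgason2000, Ch. I §1 Thm 1.14 (13) p. 96] [cite: Breitung1994, Thm 41 p. 56]
[cite: GarciaperezGonzalezarroyoOkawa2017, §2.3, §2.5] -/
theorem haar_restrict_sliceChartMap_image_eq_map_withDensity_ladder (hAu : A ∈ Matrix.unitaryGroup (Fin N) ℂ)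
    (hBu : B ∈ Matrix.unitaryGroup (Fin N) ℂ) (hω : IsPrimitiveRoot ω N) (hAB : A * B = ω • (B * A)) (hNm : 2 ≤ N * (m + 1))
    (hL : ∀ e, ladderField (n₀ := m + 1) (n₁ := m + 1) (n₂ := n₂') (n₃ := n₃') ![A, B, Γ₂, Γ₃] e ∈ Matrix.specialUnitaryGroup (Fin N) ℂ)
    (T : V ≃L[ℝ] (suFields N (m + 1) (m + 1) n₂' n₃' ×
      realCoulombSlice (ladderField (n₀ := m + 1) (n₁ := m + 1) (n₂ := n₂') (n₃ := n₃') ![A, B, Γ₂, Γ₃])))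
    (μ : Measure (FinTorusSite (m + 1) (m + 1) n₂' n₃' × Fin 4 → Matrix.specialUnitaryGroup (Fin N) ℂ)) [μ.IsHaarMeasure] :
    ∃ W : Set V, IsOpen W ∧ (0 : V) ∈ W ∧ InjOn (sliceChartMap hL (slicePsiSuDeriv hAu hBu hω hAB hNm hL) T) W ∧
      ContinuousOn (sliceChartDensity hL (slicePsiSuDeriv hAu hBu hω hAB hNm hL) T μ) W ∧
      (∀ z ∈ W, ∀ (x : FinTorusSite (m + 1) (m + 1) n₂' n₃') (μ' : Fin 4),
        ((sliceChartMap hL (slicePsiSuDeriv hAu hBu hω hAB hNm hL) T z (x, μ') : Matrix.specialUnitaryGroup (Fin N) ℂ) :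
            Matrix (Fin N) (Fin N) ℂ) =
          orbitFluct (ladderField (n₀ := m + 1) (n₁ := m + 1) (n₂ := n₂') (n₃ := n₃') ![A, B, Γ₂, Γ₃]) (suDataIncl _ (T z)) μ' x) ∧
      μ.restrict (sliceChartMap hL (slicePsiSuDeriv hAu hBu hω hAB hNm hL) T '' W) =
        (((volume : Measure V).restrict W).withDensity fun z =>
            ENNReal.ofReal (sliceChartDensity hL (slicePsiSuDeriv hAu hBu hω hAB hNm hL) T μ z)).map
          (sliceChartMap hL (slicePsiSuDeriv hAu hBu hω hAB hNm hL) T) :=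
  haar_restrict_sliceChartMap_image_eq_map_withDensity hL (slicePsiSuDeriv hAu hBu hω hAB hNm hL) T
    (isOpen_sliceChart_source hAu hBu hω hAB hNm hL) (zero_mem_sliceChart_source hAu hBu hω hAB hNm hL)
    (injOn_slicePsiSu_sliceChart_source hAu hBu hω hAB hNm hL) μ

end Ladder

end Summit.QuantumFields.YangMills.Cruxes.IRcof.TwistedSlab

end
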